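import Literature.NumberTheory.Transcendental.SlabCharts
import Literature.NumberTheory.Transcendental.SemialgebraicRootSelection
import Literature.Analysis.Calculus.MonomialUnits
import Mathlib.Topology.Algebra.Module.FiniteDimension
import HarnessLib

/-!
# Jung's projection method: the sheared slab charts over a prepared base chart

Given a base chart `χ : ℝᵈ → ℝᵈ` of the tree's FORMAT which is moreover analytic on a box
`(−δ, 1+δ)ᵈ`, real walls `W_0 < ⋯ < W_{p-1}` (functions of the base point, analytic on the box,
increasing over the open cube) which over the open cube are exactly the real roots of a polynomial
`q ∈ ℚ[x_0, …, x_d]` along `χ` (so that they are `ℚ`-semialgebraic by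
`isSemialgebraicFunOn_root_comp`), and a rational shear `Sh_v(z) = ((z_i + v_i z_d)_i, z_d)`, the
sheared slab chart
`Ψ_K(z) = Sh_v (χ(z'), W_K(z') + z_d (W_{K+1}(z') − W_K(z')))`
is of FORMAT and maps the open cube onto the sheared open slab between the walls `W_K < W_{K+1}`
over `χ((0,1)ᵈ)` (`slabChart_sheared_format`). Namespace
`Literature.NumberTheory.Transcendental.JungPreparation`.

## References

* H. W. E. Jung, J. reine angew. Math. 133 (1908); J. Kollár, *Lectures on Resolution of
  Singularities* (2007), §2.3; J. Bochnak, M. Coste, M.-F. Roy, *Real Algebraic Geometry* (1998),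
  §2.2.
-/

noncomputable section

open Set
open Literature.ModelTheory.ExponentialFields (IsSemialgebraic)
open Literature.Analysis.Calculus

namespace Literature.NumberTheory.Transcendental.JungPreparation

variable {d : ℕ}

/-- The rational shear `Sh_v(z) = ((z_i + v_i z_d)_i, z_d)` as a continuous linear automorphism of
`ℝᵈ⁺¹` (inverse `Sh_{-v}`). [folklore] -/
theorem exists_shear_continuousLinearEquiv (v : Fin d → ℚ) :
    ∃ T : (Fin (d + 1) → ℝ) ≃L[ℝ] (Fin (d + 1) → ℝ), ∀ z, T z =
      Fin.snoc (fun i : Fin d => z (Fin.castSucc i) + algebraMap ℚ ℝ (v i) * z (Fin.last d))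
        (z (Fin.last d)) := by
  set cvec : Fin (d + 1) → ℝ := Fin.snoc (fun i : Fin d => algebraMap ℚ ℝ (v i)) 0 with hcvec
  set L : (Fin (d + 1) → ℝ) →ₗ[ℝ] (Fin (d + 1) → ℝ) :=
    LinearMap.id + (LinearMap.proj (Fin.last d)).smulRight cvec with hL
  set L' : (Fin (d + 1) → ℝ) →ₗ[ℝ] (Fin (d + 1) → ℝ) :=
    LinearMap.id - (LinearMap.proj (Fin.last d)).smulRight cvec with hL'
  have hclast : cvec (Fin.last d) = 0 := by simp [hcvec]
  have hLL' : ∀ z, L (L' z) = z := fun z => by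
    simp only [hL, hL', LinearMap.add_apply, LinearMap.sub_apply, LinearMap.id_apply,
      LinearMap.smulRight_apply, LinearMap.proj_apply, Pi.sub_apply, Pi.smul_apply, hclast,
      smul_eq_mul, mul_zero, sub_zero]
    abel
  have hL'L : ∀ z, L' (L z) = z := fun z => by
    simp only [hL, hL', LinearMap.add_apply, LinearMap.sub_apply, LinearMap.id_apply,
      LinearMap.smulRight_apply, LinearMap.proj_apply, Pi.add_apply, Pi.smul_apply, hclast,
      smul_eq_mul, mul_zero, add_zero]
    abel
  let E : (Fin (d + 1) → ℝ) ≃ₗ[ℝ] (Fin (d + 1) → ℝ) :=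
    { L with invFun := L', left_inv := hL'L, right_inv := hLL' }
  refine ⟨E.toContinuousLinearEquiv, fun z => ?_⟩
  change L z = _
  funext i
  refine Fin.lastCases ?_ (fun j => ?_) i
  · simp [hL, hclast]
  · simp [hL, hcvec, mul_comm]

/-- The rational shear is a `ℚ`-semialgebraic (indeed polynomial) map. [folklore] -/
theorem isSemialgebraicMapOn_shear (v : Fin d → ℚ) :
    IsSemialgebraicMapOn ℚ (Set.univ : Set (Fin (d + 1) → ℝ)) (fun z : Fin (d + 1) → ℝ =>
      (Fin.snoc (fun i : Fin d => z (Fin.castSucc i) + algebraMap ℚ ℝ (v i) * z (Fin.last d))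
        (z (Fin.last d)) : Fin (d + 1) → ℝ)) := by
  refine (isSemialgebraicMapOn_aeval Literature.ModelTheory.ExponentialFields.isSemialgebraic_univ
    (Fin.snoc (fun i : Fin d => MvPolynomial.X (Fin.castSucc i) +
      MvPolynomial.C (v i) * MvPolynomial.X (Fin.last d)) (MvPolynomial.X (Fin.last d)))).congr
    fun z _ => ?_
  funext i
  refine Fin.lastCases ?_ (fun j => ?_) i
  · simp
  · simp

/-- **The sheared slab chart is of FORMAT and parametrises the sheared open slab.** See the
module docstring (Jung 1908; Kollár 2007, §2.3). [folklore] -/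
theorem slabChart_sheared_format {δ : ℝ} (hδ : 0 < δ) (χ : (Fin d → ℝ) → (Fin d → ℝ))
    (hχa : AnalyticOnNhd ℝ χ (Set.pi Set.univ (fun _ : Fin d => Ioo (-δ) (1 + δ))))
    (hχs : IsSemialgebraicMapOn ℚ (Set.pi Set.univ (fun _ : Fin d => Ioo (0 : ℝ) 1)) χ)
    (hχi : InjOn χ (Set.pi Set.univ (fun _ : Fin d => Ioo (0 : ℝ) 1)))
    (hχd : ∀ x ∈ Set.pi Set.univ (fun _ : Fin d => Ioo (0 : ℝ) 1), (fderiv ℝ χ x).det ≠ 0)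
    {p : ℕ} (W : Fin p → (Fin d → ℝ) → ℝ)
    (hWa : ∀ m, AnalyticOnNhd ℝ (W m) (Set.pi Set.univ (fun _ : Fin d => Ioo (-δ) (1 + δ))))
    (hWmono : ∀ σ ∈ Set.pi Set.univ (fun _ : Fin d => Ioo (0 : ℝ) 1), StrictMono fun m => W m σ)
    (q : MvPolynomial (Fin (d + 1)) ℚ)
    (hWroots : ∀ σ ∈ Set.pi Set.univ (fun _ : Fin d => Ioo (0 : ℝ) 1), ∀ t : ℝ,
      MvPolynomial.aeval (Fin.snoc (χ σ) t : Fin (d + 1) → ℝ) q = 0 ↔ ∃ m, t = W m σ)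
    (v : Fin d → ℚ) {K : ℕ} (hK : K + 1 < p) (Ψ : (Fin (d + 1) → ℝ) → (Fin (d + 1) → ℝ))
    (hΨ : ∀ z, Ψ z = Fin.snoc (fun i : Fin d => χ (Fin.init z) i + algebraMap ℚ ℝ (v i) *
        (W ⟨K, Nat.lt_of_succ_lt hK⟩ (Fin.init z) + z (Fin.last d) *
          (W ⟨K + 1, hK⟩ (Fin.init z) - W ⟨K, Nat.lt_of_succ_lt hK⟩ (Fin.init z))))
        (W ⟨K, Nat.lt_of_succ_lt hK⟩ (Fin.init z) + z (Fin.last d) *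
          (W ⟨K + 1, hK⟩ (Fin.init z) - W ⟨K, Nat.lt_of_succ_lt hK⟩ (Fin.init z)))) :
    (AnalyticOnNhd ℝ Ψ (Set.pi Set.univ (fun _ : Fin (d + 1) => Icc (0 : ℝ) 1)) ∧
      IsSemialgebraicMapOn ℚ (Set.pi Set.univ (fun _ : Fin (d + 1) => Ioo (0 : ℝ) 1)) Ψ ∧
      InjOn Ψ (Set.pi Set.univ (fun _ : Fin (d + 1) => Ioo (0 : ℝ) 1)) ∧
      ∀ z ∈ Set.pi Set.univ (fun _ : Fin (d + 1) => Ioo (0 : ℝ) 1), (fderiv ℝ Ψ z).det ≠ 0) ∧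
    Ψ '' Set.pi Set.univ (fun _ : Fin (d + 1) => Ioo (0 : ℝ) 1) =
      (fun u : Fin (d + 1) → ℝ => (Fin.snoc (fun i : Fin d => u (Fin.castSucc i) +
        algebraMap ℚ ℝ (v i) * u (Fin.last d)) (u (Fin.last d)) : Fin (d + 1) → ℝ)) ''
        {u : Fin (d + 1) → ℝ | ∃ σ ∈ Set.pi Set.univ (fun _ : Fin d => Ioo (0 : ℝ) 1),
          Fin.init u = χ σ ∧ u (Fin.last d) ∈ Ioo (W ⟨K, Nat.lt_of_succ_lt hK⟩ σ) (W ⟨K + 1, hK⟩ σ)} := by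
  set lo := W ⟨K, Nat.lt_of_succ_lt hK⟩ with hlo
  set hi := W ⟨K + 1, hK⟩ with hhi
  set Ψ₀ : (Fin (d + 1) → ℝ) → (Fin (d + 1) → ℝ) := fun z =>
    Fin.snoc (χ (Fin.init z)) (lo (Fin.init z) + z (Fin.last d) * (hi (Fin.init z) - lo (Fin.init z)))
    with hΨ₀def
  have hΨ₀ : ∀ z, Ψ₀ z = Fin.snoc (χ (Fin.init z))
      (lo (Fin.init z) + z (Fin.last d) * (hi (Fin.init z) - lo (Fin.init z))) := fun z => rfl
  obtain ⟨T, hT⟩ := exists_shear_continuousLinearEquiv v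
  have hΨT : Ψ = T ∘ Ψ₀ := by
    funext z
    rw [hΨ, Function.comp_apply, hT, hΨ₀]
    simp only [Fin.snoc_castSucc, Fin.snoc_last]
  have hcube : Set.pi Set.univ (fun _ : Fin d => Icc (0 : ℝ) 1) ⊆
      Set.pi Set.univ (fun _ : Fin d => Ioo (-δ) (1 + δ)) := pi_Icc_subset_box hδ
  have hO := isSemialgebraic_pi_Ioo_unit d
  have hlt : ∀ σ ∈ Set.pi Set.univ (fun _ : Fin d => Ioo (0 : ℝ) 1), lo σ < hi σ := fun σ hσ =>
    hWmono σ hσ (Fin.mk_lt_mk.2 K.lt_succ_self)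
  -- the walls are `ℚ`-semialgebraic on the open cube
  have hWs : ∀ m, IsSemialgebraicFunOn ℚ (Set.pi Set.univ (fun _ : Fin d => Ioo (0 : ℝ) 1)) (W m) :=
    isSemialgebraicFunOn_root_comp hO hχs q hWmono hWroots
  obtain ⟨h1, h2, h3, h4⟩ := slabChart_format χ lo hi Ψ₀ hΨ₀ (hχa.mono hcube) hχs hχi hχd
    ((hWa _).mono hcube) ((hWa _).mono hcube) (hWs _) (hWs _) hlt
  refine ⟨?_, ?_⟩
  · rw [hΨT]
    exact format_comp_continuousLinearEquiv T ((isSemialgebraicMapOn_shear v).congr fun z _ => (hT z).symm)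
      h1 h2 h3 h4
  · rw [hΨT, Set.image_comp, image_slabChart χ lo hi Ψ₀ hΨ₀ hlt]
    congr 1
    funext u
    exact hT u

end Literature.NumberTheory.Transcendental.JungPreparation
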